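import Literature.AlgebraicGeometry.Resolution.ArithmeticalThreefoldsLocalRankReductionLU2
import Literature.AlgebraicGeometry.Resolution.ArithmeticalThreefoldsLocalRankReductionEmbedded
import Literature.AlgebraicGeometry.Resolution.EmbeddedResolutionExcellentSurfacesCor15
import Literature.AlgebraicGeometry.Resolution.ArithmeticalThreefoldsLocalReductionCJS
import HarnessLib

/-!
# Cossart–Piltant 2019, Prop. 4.10: the rank-one reduction (C5) from the abstract dimension-two model lemma — the frame

Topic: `Literature/AlgebraicGeometry/Resolution` (proofs only: no new notions, no new named facts).

`ArithmeticalThreefoldsLocalRankReduction.lean` proves the reduction of local uniformization in Cossart–Piltant's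
climbing frame to RANK-ONE valuations (hypothesis (C5) of `cossartPiltant2019ReductionP_of_parts`) from resolution
of excellent surfaces in the NON-embedded form `CossartJannsenSaito2020General`, which enters only through the
model lemma `exists_model_regular_of_cjs` (a finitely generated model whose local ring at the centre has dimension
`≤ 2` can be enlarged to one that is regular at the centre).  This file repeats the three downstream steps with that
lemma as an explicit HYPOTHESIS `hLU2` (stated over the base ring `S`, for every field, valuation ring and model):

* `exists_residueModel_regular_of_lu2` — the residue-side model of `ν₂` (Novacoski–Spivakovsky Cor. 2.17 input);
* `exists_model_regular_of_lt_of_lu2` — regular models for composite valuations (NS §3.1);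
* `rankOne_reduction_of_lu2` — (C5) from `hLU2`.

So (C5) follows from ANY source of the dimension-two model lemma — in particular from the EMBEDDED theorem CJS
Thm. 1.4 (`B = ∅`) over a regular excellent base (`exists_model_regular_of_cjsEmbedded`,
`ArithmeticalThreefoldsLocalRankReductionEmbedded.lean`), which is how the `CleanModels` crux of the summit
`ResolutionOfSingularities` keys Cossart–Piltant's Prop. 4.10 on its stub 1.  Proofs are those of the original file
verbatim, with the model lemma abstracted.

## Sources

* V. Cossart, O. Piltant, *Resolution of singularities of arithmetical threefolds*, J. Algebra 529 (2019),
  proof of Prop. 4.10 (arXiv v1: Prop. 4.8, p. 53). [CossartPiltant2019]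
* J. Novacoski, M. Spivakovsky, *Reduction of local uniformization to the rank one case* (2014), Thm. 1.1,
  Cor. 2.14, Cor. 2.17, §3.1. [NovacoskiSpivakovsky2014]
-/

noncomputable section

open CategoryTheory AlgebraicGeometry IsLocalRing Polynomial IntermediateField

namespace Literature.AlgebraicGeometry.Resolution

universe u

/-! ## The reduction to rank one in Cossart–Piltant's frame -/

/-- **Cossart–Piltant 2019, Prop. 4.10, the reduction to rank-one valuations** ("By [NSp]
Theorem 1.1 or [CoP1] Proposition 5.1 it can be assumed that `v` has rank one; transcendental
residue extensions provide a reduction in `dim A` after blowing up"), from the abstract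
dimension-two model lemma `hLU2`: in the climbing frame — `S` an excellent
regular local domain of dimension three, `E ⊇ S` an algebraic (algebraically closed) field,
valuation rings `O_E` of `E` dominating `S` with residue field algebraic over that of `S`,
local uniformization by finitely generated models `S[t]` — local uniformization for the
RANK-ONE such `O_E` implies it for all of them. For `O_E` not of rank one there is
`O_E < O₁ < E` (`nonempty_rankOne_of_overrings`); at the level field `K = F(s₀)` the two rings
restrict to `O < O₁ < K` (`eq_of_le_of_comap_eq`; valuation rings are integrally closed), and
`exists_model_regular_of_lt_of_lu2` produces the regular model, read back in `E` along `K ⊆ E`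
(`ModelTransport.lean`). This is hypothesis `hC5` of `cossartPiltant2019ReductionP_of_parts`
(up to its redundant `[IsDomain S]` binder) with the abstract dimension-two model lemma `hLU2` over `S` inserted
as an extra premise after the binders of `S`
(supplied by `exists_model_regular_of_cjs` from CJS Thm. 1.2, or by `exists_model_regular_of_cjsEmbedded` from
CJS Thm. 1.4 with `B = ∅`).
[cite: CossartPiltant2019, proof of Prop. 4.10 (arXiv v1: Prop. 4.8, p. 53)]
[cite: NovacoskiSpivakovsky2014, Thm. 1.1] [cite: CossartJannsenSaito2020, Thm. 1.2] -/
theorem rankOne_reduction_of_lu2 :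
    ∀ (p : ℕ), p.Prime →
    ∀ (S : Type u) [CommRing S] [IsRegularLocalRing S],
      (∀ (K : Type u) [Field K] [Algebra S K] (O' : ValuationSubring K) (R : Subalgebra S K),
        R.FG → ∀ [IsNoetherianRing R] [IsFractionRing R K], R.toSubring ≤ O'.toSubring →
        ∀ (P' : Ideal R) [P'.IsPrime], (∀ z : R, z ∈ P' ↔ O'.valuation (z : K) < 1) →
        ringKrullDim (Localization.AtPrime P') ≤ 2 →
        ∃ (A₁ : Subalgebra S K) (hA₁ : A₁.toSubring ≤ O'.toSubring), R ≤ A₁ ∧ A₁.FG ∧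
          IsRegularLocalRing (Localization.AtPrime ((maximalIdeal O').comap (Subring.inclusion hA₁)))) →
      IsExcellentRing S → ringKrullDim S = 3 → CharP (ResidueField S) p →
      IsAdicComplete (maximalIdeal S) S →
    ∀ (E : Type u) [Field E] [Algebra S E], Function.Injective (algebraMap S E) →
      IsAlgClosed E → Algebra.IsAlgebraic S E →
    (∀ (OE : ValuationSubring E), Nonempty OE.valuation.RankOne →
      (∀ s : S, algebraMap S E s ∈ OE) →
      (∀ s ∈ maximalIdeal S, OE.valuation (algebraMap S E s) < 1) →
      (∀ y : OE, ∃ q : S[X], (∃ i, q.coeff i ∉ maximalIdeal S) ∧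
        OE.valuation (q.eval₂ (algebraMap S E) y) < 1) →
      ∀ s₀ : Finset E, ∃ t : Finset E,
          (t : Set E) ⊆ Subfield.closure (Set.range (algebraMap S E) ∪ (s₀ : Set E)) ∧
          (s₀ : Set E) ⊆ Subfield.closure (Set.range (algebraMap S E) ∪ (t : Set E)) ∧
          ∃ hTO : (Algebra.adjoin S (t : Set E)).toSubring ≤ OE.toSubring,
            IsRegularLocalRing (Localization.AtPrime
              (Ideal.comap (Subring.inclusion hTO) (maximalIdeal OE)))) →
    ∀ (OE : ValuationSubring E), (∀ s : S, algebraMap S E s ∈ OE) →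
      (∀ s ∈ maximalIdeal S, OE.valuation (algebraMap S E s) < 1) →
      (∀ y : OE, ∃ q : S[X], (∃ i, q.coeff i ∉ maximalIdeal S) ∧
        OE.valuation (q.eval₂ (algebraMap S E) y) < 1) →
      ∀ s₀ : Finset E, ∃ t : Finset E,
          (t : Set E) ⊆ Subfield.closure (Set.range (algebraMap S E) ∪ (s₀ : Set E)) ∧
          (s₀ : Set E) ⊆ Subfield.closure (Set.range (algebraMap S E) ∪ (t : Set E)) ∧
          ∃ hTO : (Algebra.adjoin S (t : Set E)).toSubring ≤ OE.toSubring,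
            IsRegularLocalRing (Localization.AtPrime
              (Ideal.comap (Subring.inclusion hTO) (maximalIdeal OE))) := by
  intro p _ S _ _ hLU2 hS hSdim _ _ E _ _ hinj _ halg hrank OE hSO hdom hres s₀
  classical
  by_cases hr : Nonempty OE.valuation.RankOne
  · exact hrank OE hr hSO hdom hres s₀
  haveI : IsDomain S := isDomain_of_isRegularLocalRing S
  haveI : IsNoetherianRing S := hS.isUniversallyCatenaryRing.1
  haveI := halg
  -- `𝔪_S ≠ 0`, so `O_E ≠ E`
  obtain ⟨s, hsm, hs0⟩ : ∃ s ∈ maximalIdeal S, s ≠ 0 := by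
    by_contra h
    push Not at h
    have h0 : maximalIdeal S = ⊥ := le_bot_iff.mp fun s hs => (Submodule.mem_bot S).mpr (h s hs)
    have hfield : IsField S := IsLocalRing.isField_iff_maximalIdeal_eq.mpr h0
    have hdim0 := ringKrullDim_eq_zero_of_isField hfield
    rw [hSdim] at hdim0
    exact absurd hdim0 (by decide)
  have hOEtop : OE ≠ ⊤ := by
    intro htop
    have ha0 : algebraMap S E s ≠ 0 := fun h => hs0 (hinj (by rw [h, map_zero]))
    have h1 : OE.valuation (algebraMap S E s) < 1 := hdom s hsm
    have h2 : (algebraMap S E s)⁻¹ ∈ OE := by rw [htop]; exact ValuationSubring.mem_top _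
    have h3 := (OE.valuation_le_one_iff _).mpr h2
    rw [map_inv₀, inv_le_one₀ ((Valuation.pos_iff _).mpr ha0)] at h3
    exact not_lt.mpr h3 h1
  -- a valuation ring strictly between `O_E` and `E`
  obtain ⟨O₁', hle', hne', htop'⟩ : ∃ O₁' : ValuationSubring E, OE ≤ O₁' ∧ O₁' ≠ OE ∧ O₁' ≠ ⊤ := by
    by_contra h
    push Not at h
    refine hr (nonempty_rankOne_of_overrings OE hOEtop fun T hT => ?_)
    by_cases hT' : T = OE
    · exact Or.inl hT'
    · exact Or.inr (h T hT hT')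
  -- the level field `K = F(s₀)` as a type
  let M : Subfield E := Subfield.closure (Set.range (algebraMap S E) ∪ (s₀ : Set E))
  have hSM : ∀ s : S, algebraMap S E s ∈ M := fun s => Subfield.subset_closure (Or.inl ⟨s, rfl⟩)
  have hs₀M : ∀ z ∈ s₀, z ∈ M := fun z hz => Subfield.subset_closure (Or.inr hz)
  let K : Type u := M
  letI : Algebra S K := ((algebraMap S E).codRestrict M hSM).toAlgebra
  haveI : IsScalarTower S K E := IsScalarTower.of_algebraMap_eq fun _ => rfl
  haveI : FaithfulSMul S K := (faithfulSMul_iff_algebraMap_injective S K).mpr fun a b hab =>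
    hinj (by
      have h := congrArg (fun z : K => (z : E)) hab
      exact h)
  haveI : Algebra.IsAlgebraic S K :=
    Algebra.IsAlgebraic.of_injective (IsScalarTower.toAlgHom S K E) Subtype.val_injective
  haveI : Algebra.IsAlgebraic K E :=
    Algebra.IsAlgebraic.extendScalars (R := S) (FaithfulSMul.algebraMap_injective S K)
  -- the two valuation rings restricted to `K`
  let O : ValuationSubring K := OE.comap (algebraMap K E)
  let O₁ : ValuationSubring K := O₁'.comap (algebraMap K E)
  have hO : O ≤ O₁ := fun z hz => hle' hz
  have hvalK : ∀ z : K, O.valuation z < 1 ↔ OE.valuation (z : E) < 1 := fun z =>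
    valuation_comap_lt_one_iff OE (algebraMap K E) z
  have hne : O ≠ O₁ := fun h => hne' (ValuationSubring.eq_of_le_of_comap_eq (F := K) hle' h).symm
  have hO₁top : O₁ ≠ ⊤ := by
    intro htop
    have hKO₁' : ∀ z : K, (z : E) ∈ O₁' := fun z => by
      have hz : z ∈ O₁ := by rw [htop]; exact ValuationSubring.mem_top z
      exact hz
    apply htop'
    ext w
    simp only [ValuationSubring.mem_top, iff_true]
    have hint : IsIntegral K w := (Algebra.IsAlgebraic.isAlgebraic (R := K) w).isIntegral
    let Ov : Subring E := O₁'.valuation.integer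
    have hOv : ∀ z, z ∈ Ov ↔ z ∈ O₁' := fun z => by
      rw [Valuation.mem_integer_iff, O₁'.valuation_le_one_iff]
    letI : Algebra K Ov :=
      ((algebraMap K E).codRestrict Ov (fun z => (hOv _).mpr (hKO₁' z))).toAlgebra
    haveI : IsScalarTower K Ov E := IsScalarTower.of_algebraMap_eq fun _ => rfl
    have hint' : IsIntegral Ov w := hint.tower_top
    exact (hOv w).mp ((Valuation.integer.integers O₁'.valuation).mem_of_integral hint')
  have hSO_K : ∀ s : S, algebraMap S K s ∈ O := fun s => by
    change algebraMap S E s ∈ OE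
    exact hSO s
  have hdomK : ∀ s ∈ maximalIdeal S, O.valuation (algebraMap S K s) < 1 := fun s hs =>
    (hvalK _).mpr (hdom s hs)
  have hresK : ∀ y : O, ∃ q : S[X], (∃ i, q.coeff i ∉ maximalIdeal S) ∧
      O.valuation (q.eval₂ (algebraMap S K) y) < 1 := fun y => by
    obtain ⟨q, hq, hv⟩ := hres ⟨((y : K) : E), y.2⟩
    refine ⟨q, hq, ?_⟩
    rw [hvalK]
    have h : (((q.eval₂ (algebraMap S K) (y : K)) : K) : E) =
        q.eval₂ (algebraMap S E) ((y : K) : E) := by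
      change algebraMap K E (q.eval₂ (algebraMap S K) (y : K)) = _
      rw [Polynomial.hom_eval₂, ← IsScalarTower.algebraMap_eq]
      rfl
    rw [h]
    exact hv
  -- a first model `R = S[g(s₀)] ⊆ O` with `Frac R = K`
  let g : K → K := fun z => if z ∈ O then z else z⁻¹
  have hg : ∀ z, g z ∈ O := by
    intro z
    by_cases hz : z ∈ O
    · simp only [g, hz, if_true]
    · simp only [g, hz, if_false]; exact (O.mem_or_inv_mem z).resolve_left hz
  let s₀K : Finset K := s₀.attach.image fun z => g ⟨z.1, hs₀M z.1 z.2⟩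
  let R : Subalgebra S K := Algebra.adjoin S (s₀K : Set K)
  have hRO : R.toSubring ≤ O.toSubring := by
    have : R ≤ ({ O.toSubring with algebraMap_mem' := hSO_K } : Subalgebra S K) := by
      refine Algebra.adjoin_le ?_
      intro z hz
      obtain ⟨w, -, rfl⟩ := Finset.mem_image.mp (Finset.mem_coe.mp hz)
      exact hg _
    exact fun z hz => this hz
  have hRfg : R.FG := Subalgebra.fg_adjoin_finset _
  have hgen : ∀ z : K, z ∈ Subfield.closure (R : Set K) := by
    intro z
    have hle : M ≤ (Subfield.closure (R : Set K)).map (algebraMap K E) := by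
      refine Subfield.closure_le.mpr ?_
      rintro w (⟨s, rfl⟩ | hw)
      · exact ⟨algebraMap S K s, Subfield.subset_closure (R.algebraMap_mem s), rfl⟩
      · let wK : K := ⟨w, hs₀M w hw⟩
        have hgw : g wK ∈ R := Algebra.subset_adjoin (by
          rw [Finset.mem_coe]
          exact Finset.mem_image.mpr ⟨⟨w, hw⟩, Finset.mem_attach _ _, rfl⟩)
        refine ⟨wK, ?_, rfl⟩
        by_cases hwO : wK ∈ O
        · have h1 : g wK = wK := if_pos hwO
          rw [← h1]; exact Subfield.subset_closure hgw
        · have h1 : g wK = wK⁻¹ := if_neg hwO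
          have hinv : wK⁻¹ ∈ Subfield.closure (R : Set K) := by
            rw [← h1]; exact Subfield.subset_closure hgw
          have h2 := Subfield.inv_mem _ hinv
          rwa [inv_inv] at h2
    obtain ⟨z', hz', hzz'⟩ := hle z.2
    have h : z' = z := Subtype.ext hzz'
    rw [← h]; exact hz'
  haveI hRfrac : IsFractionRing R K := by
    refine IsFractionRing.of_field R K fun z => ?_
    obtain ⟨a, ha, b, hb, hab⟩ := Subfield.mem_closure_iff.mp (hgen z)
    have hcl : Subring.closure (R : Set K) = R.toSubring := Subring.closure_eq R.toSubring
    rw [hcl] at ha hb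
    exact ⟨⟨a, ha⟩, ⟨b, hb⟩, hab.symm⟩
  -- the regular model at the level `K`
  obtain ⟨A₃, hA₃, hRA₃, hA₃fg, hreg₃⟩ := exists_model_regular_of_lt_of_lu2 hLU2 hS hSdim O O₁ hO hne
    hO₁top hSO_K hdomK hresK R hRfg hRO
  -- back to `E`
  obtain ⟨g₃, hg₃⟩ := hA₃fg
  let valₐ : K →ₐ[S] E := IsScalarTower.toAlgHom S K E
  let t : Finset E := g₃.image (fun z : K => (z : E))
  have hA₃map : (A₃.map valₐ : Subalgebra S E) = Algebra.adjoin S (t : Set E) := by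
    rw [← hg₃, AlgHom.map_adjoin, Finset.coe_image]
    rfl
  haveI : IsFractionRing A₃ K := isFractionRing_subalgebra_of_le R A₃ hRA₃
  have hsub : ∀ w : E, w ∈ Algebra.adjoin S (t : Set E) →
      w ∈ Subfield.closure (Set.range (algebraMap S E) ∪ (t : Set E)) := by
    intro w hw
    have hw' : w ∈ (Algebra.adjoin S (t : Set E)).toSubring := hw
    rw [Algebra.adjoin_eq_ring_closure] at hw'
    exact (Subring.closure_le (t := (Subfield.closure
      (Set.range (algebraMap S E) ∪ (t : Set E))).toSubring)).mpr
      (fun u hu => Subfield.subset_closure hu) hw'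
  have hmapO : (A₃.map valₐ).toSubring ≤ OE.toSubring := by
    intro z hz
    obtain ⟨w, hw, rfl⟩ := Subalgebra.mem_map.mp hz
    exact hA₃ hw
  have hTO : (Algebra.adjoin S (t : Set E)).toSubring ≤ OE.toSubring := by
    rw [← hA₃map]; exact hmapO
  refine ⟨t, ?_, ?_, hTO, ?_⟩
  · intro z hz
    obtain ⟨w, -, rfl⟩ := Finset.mem_image.mp (Finset.mem_coe.mp hz)
    exact w.2
  · intro z hz
    let zK : K := ⟨z, hs₀M z hz⟩
    obtain ⟨a, b, -, hab⟩ := IsFractionRing.div_surjective (A := A₃) zK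
    have ha : ((a : K) : E) ∈ Algebra.adjoin S (t : Set E) := by
      rw [← hA₃map]; exact Subalgebra.mem_map.mpr ⟨a, a.2, rfl⟩
    have hb : ((b : K) : E) ∈ Algebra.adjoin S (t : Set E) := by
      rw [← hA₃map]; exact Subalgebra.mem_map.mpr ⟨b, b.2, rfl⟩
    have hz' : z = ((a : K) : E) / ((b : K) : E) := by
      have h := congrArg Subtype.val hab
      rw [Subfield.coe_div] at h
      exact h.symm
    rw [hz']
    exact div_mem (hsub _ ha) (hsub _ hb)
  · let P₃ : Ideal A₃ := (maximalIdeal O).comap (Subring.inclusion hA₃)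
    haveI : P₃.IsPrime := Ideal.IsPrime.comap _
    have hP₃ : ∀ z : A₃, z ∈ P₃ ↔ OE.valuation (valₐ z) < 1 := fun z => by
      rw [Ideal.mem_comap, ValuationSubring.valuation_lt_one_iff]
      exact hvalK z
    let Q₃ : Ideal (A₃.map valₐ) := (maximalIdeal OE).comap (Subring.inclusion hmapO)
    haveI : Q₃.IsPrime := Ideal.IsPrime.comap _
    have hQ₃ : ∀ z : A₃.map valₐ, z ∈ Q₃ ↔ OE.valuation (z : E) < 1 := fun z => by
      rw [Ideal.mem_comap, ValuationSubring.valuation_lt_one_iff]; rfl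
    have hregQ₃ : IsRegularLocalRing (Localization.AtPrime Q₃) :=
      (isRegularLocalRing_localization_map_iff valₐ OE A₃ P₃ hP₃ Q₃ hQ₃).mp hreg₃
    let PT : Ideal (Algebra.adjoin S (t : Set E)) := (maximalIdeal OE).comap (Subring.inclusion hTO)
    haveI : PT.IsPrime := Ideal.IsPrime.comap _
    have hPT : ∀ z : Algebra.adjoin S (t : Set E), z ∈ PT ↔ OE.valuation (z : E) < 1 := fun z => by
      rw [Ideal.mem_comap, ValuationSubring.valuation_lt_one_iff]; rfl
    exact (isRegularLocalRing_localization_iff_of_subalgebra_eq OE hA₃map Q₃ hQ₃ PT hPT).mp hregQ₃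


/-! ## (C5) from CJS Thm. 1.4 (`B = ∅`) alone, and Prop. 4.10 keyed on the embedded theorem -/

/-- **Cossart–Piltant 2019, Prop. 4.10, the reduction to rank-one valuations from CJS Thm. 1.4 with `B = ∅`
ALONE** — VERBATIM the hypothesis `hC5` of `cossartPiltant2019ReductionP_of_principalization_of_descent` /
`…_of_parts`: `rankOne_reduction_of_lu2` fed with `exists_model_regular_of_cjsEmbedded` (the base `S` is a regular
local ring, hence a regular domain by Serre's theorem, and excellent).  This replaces `rankOne_reduction_of_cjs`
(keyed on the non-embedded `CossartJannsenSaito2020General`) in the chain for `CossartPiltant2019ReductionP`.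
[cite: CossartPiltant2019, proof of Prop. 4.10 (arXiv v1: Prop. 4.8, p. 53)]
[cite: CossartJannsenSaito2020, Thm. 1.4] [cite: NovacoskiSpivakovsky2014, Thm. 1.1] -/
theorem rankOne_reduction_of_cjsEmbedded (hCJSE : CossartJannsenSaito2020Embedded.{u}) :
    ∀ (p : ℕ), p.Prime →
    ∀ (S : Type u) [CommRing S] [IsRegularLocalRing S],
      IsExcellentRing S → ringKrullDim S = 3 → CharP (ResidueField S) p →
      IsAdicComplete (maximalIdeal S) S →
    ∀ (E : Type u) [Field E] [Algebra S E], Function.Injective (algebraMap S E) →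
      IsAlgClosed E → Algebra.IsAlgebraic S E →
    (∀ (OE : ValuationSubring E), Nonempty OE.valuation.RankOne →
      (∀ s : S, algebraMap S E s ∈ OE) →
      (∀ s ∈ maximalIdeal S, OE.valuation (algebraMap S E s) < 1) →
      (∀ y : OE, ∃ q : S[X], (∃ i, q.coeff i ∉ maximalIdeal S) ∧
        OE.valuation (q.eval₂ (algebraMap S E) y) < 1) →
      ∀ s₀ : Finset E, ∃ t : Finset E,
          (t : Set E) ⊆ Subfield.closure (Set.range (algebraMap S E) ∪ (s₀ : Set E)) ∧
          (s₀ : Set E) ⊆ Subfield.closure (Set.range (algebraMap S E) ∪ (t : Set E)) ∧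
          ∃ hTO : (Algebra.adjoin S (t : Set E)).toSubring ≤ OE.toSubring,
            IsRegularLocalRing (Localization.AtPrime
              (Ideal.comap (Subring.inclusion hTO) (maximalIdeal OE)))) →
    ∀ (OE : ValuationSubring E), (∀ s : S, algebraMap S E s ∈ OE) →
      (∀ s ∈ maximalIdeal S, OE.valuation (algebraMap S E s) < 1) →
      (∀ y : OE, ∃ q : S[X], (∃ i, q.coeff i ∉ maximalIdeal S) ∧
        OE.valuation (q.eval₂ (algebraMap S E) y) < 1) →
      ∀ s₀ : Finset E, ∃ t : Finset E,
          (t : Set E) ⊆ Subfield.closure (Set.range (algebraMap S E) ∪ (s₀ : Set E)) ∧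
          (s₀ : Set E) ⊆ Subfield.closure (Set.range (algebraMap S E) ∪ (t : Set E)) ∧
          ∃ hTO : (Algebra.adjoin S (t : Set E)).toSubring ≤ OE.toSubring,
            IsRegularLocalRing (Localization.AtPrime
              (Ideal.comap (Subring.inclusion hTO) (maximalIdeal OE))) := by
  intro p hp S _ _ hS
  haveI : IsDomain S := isDomain_of_isRegularLocalRing S
  haveI : IsRegularRing S := isRegularRing_of_isRegularLocalRing S
  exact rankOne_reduction_of_lu2 p hp S
    (fun K _ _ O' R hRfg _ _ hRO P' _ hP' hdim =>
      exists_model_regular_of_cjsEmbedded hCJSE hS O' R hRfg hRO P' hP' hdim) hS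

/-- **Cossart–Piltant 2019, Prop. 4.10 from Thm. 1.5, principalization, CJS Thm. 1.4 (`B = ∅`) and (C4).**
`cossartPiltant2019ReductionP_of_principalization_of_descent` with BOTH surface-resolution inputs served by the
EMBEDDED theorem `CossartJannsenSaito2020Embedded`: the hypothesis `hEmb` (CJS Cor. 1.5) by
`CossartJannsenSaito2020Embedded.cor15`, and the rank-one reduction (C5) by `rankOne_reduction_of_cjsEmbedded`.
So `CossartPiltant2019ReductionP` follows from the local theorem (Thm. 1.5), principalization (Prop. 4.4), CJS
Thm. 1.4 with `B = ∅`, and the descent (C4) below the ramification field ([CoP1] Prop. 9.3) — the non-embedded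
`CossartJannsenSaito2020General` is no longer an input.
[cite: CossartPiltant2019, Props. 4.3, 4.4 and proof of Prop. 4.10 (arXiv v1: Props. 4.2, 4.3, 4.8, pp. 50–54)]
[cite: CossartPiltant2008, Prop. 9.3 (HAL: Prop. 9.5)] [cite: CossartJannsenSaito2020, Thm. 1.4, Cor. 1.5] -/
theorem cossartPiltant2019ReductionP_of_cjsEmbedded_of_descent
    (hloc : CossartPiltant2019Local.{u}) (h44 : CossartPiltant2019Principalization.{u})
    (hCJSE : CossartJannsenSaito2020Embedded.{u})
    (hC4 :
      ∀ (p : ℕ), p.Prime →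
      ∀ (S : Type u) [CommRing S] [IsDomain S] [IsRegularLocalRing S],
        IsExcellentRing S → ringKrullDim S = 3 → CharP (ResidueField S) p →
        IsAdicComplete (maximalIdeal S) S →
      ∀ (E : Type u) [Field E] [Algebra S E], Function.Injective (algebraMap S E) →
        IsAlgClosed E → Algebra.IsAlgebraic S E →
      ∀ (OE : ValuationSubring E), (∀ s : S, algebraMap S E s ∈ OE) →
        (∀ s ∈ maximalIdeal S, OE.valuation (algebraMap S E s) < 1) →
        (∀ y : OE, ∃ q : S[X], (∃ i, q.coeff i ∉ maximalIdeal S) ∧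
          OE.valuation (q.eval₂ (algebraMap S E) y) < 1) →
      Nonempty OE.valuation.RankOne →
      ∀ (M : Subfield E), (∀ s : S, algebraMap S E s ∈ M) →
      ∀ (N : IntermediateField M E) [FiniteDimensional M N] [IsGalois M N] (K' : Subfield E),
        M ≤ K' → K' ≤ (IntermediateField.lift (IntermediateField.fixedField
          (ramificationGroupIn OE N))).toSubfield →
        (∃ t : Finset E, (t : Set E) ⊆ K' ∧
          K' ≤ Subfield.closure (Set.range (algebraMap S E) ∪ (t : Set E)) ∧
          ∃ hTO : (Algebra.adjoin S (t : Set E)).toSubring ≤ OE.toSubring,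
            IsRegularLocalRing (Localization.AtPrime
              (Ideal.comap (Subring.inclusion hTO) (maximalIdeal OE)))) →
        (∃ t : Finset E, (t : Set E) ⊆ M ∧
          M ≤ Subfield.closure (Set.range (algebraMap S E) ∪ (t : Set E)) ∧
          ∃ hTO : (Algebra.adjoin S (t : Set E)).toSubring ≤ OE.toSubring,
            IsRegularLocalRing (Localization.AtPrime
              (Ideal.comap (Subring.inclusion hTO) (maximalIdeal OE))))) :
    CossartPiltant2019ReductionP.{u} :=
  cossartPiltant2019ReductionP_of_principalization_of_descent hloc h44
    hCJSE.cor15 hC4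
    (fun p hp S _ _ _ hS hSdim hSchar hScomp E _ _ hinj hE halg =>
      rankOne_reduction_of_cjsEmbedded hCJSE p hp S hS hSdim hSchar hScomp E hinj hE halg)

end Literature.AlgebraicGeometry.Resolution

end
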